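import Summits.QuantumFields.QCD.Theses.CounterexampleMustBeHot
import Summits.QuantumFields.QCD.Theorems.QuarksAsStableActionStableActionBridgeDefs
import Summits.QuantumFields.QCD.Theorems.PauliWegnerSeaChiralGluonicCompletionRestrict
import Literature.MathematicalPhysics.QuantumFieldTheory.QCDGoldstoneBound
import Literature.MathematicalPhysics.QuantumFieldTheory.MassGapFromLatticeClustering
import HarnessLib

/-!
# Upstream bracket of stub `stub_calibratedLatticePackageT` (U1″) — crux `ThinQCD` (item stmt-QuantumFields-17278)

Route `QuarksNoInfraredClause` (sub-problem QCD), line `registered`, skeleton r6a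
(`Cruxes/ThinQCD/Lines/birth.lean`); helper file, `--supports stmt-QuantumFields-17278`.  The stub U1″ itself (the
calibrated lattice package along a chirality-keeping reindexing, r6 currency) is OPEN PHYSICS (UV stability of lattice
QCD observables with light Wilson quarks + the lattice IR/thermal inputs) and is NOT proved here.  This file lands the
KERNEL-CHECKED UPSTREAM BRACKET

  `calibratedLatticePackageT_of_upstream : A → V → B1 → D → U1″`

where A, V, B1 are the bodies of the registered stubs `stub_chiralGoldstoneSubsequence` (Goldstone subsequence),
`stub_goldstoneVolumeUpgrade` (volume upgrade keeping the Goldstone bound) and `stub_calibratedControl` (calibrated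
control: `Live ∧ TightGlobal ∧ MassLipschitz`) of the line `chiral_calibrated_convergence` of crux
`ChiralCalibratedConvergence` (item stmt-QuantumFields-18044), with that skeleton's §0 abbreviations (`GapData`,
`PolyVolume`, `Bites`, `Kappa3`, `Live`, `TightGlobal`, `MassLipschitz`) UNFOLDED VERBATIM (they live in a `Cruxes/` file
and cannot be imported; no definition is introduced here), and D is the DELIVERABLES LAW of the certified re-type 18044′
(`Cruxes/ConvergentOSClosure/Retype-signatures.md` §3; no producer item yet): for `N_f ∈ {2,3}`, every `reg₁` with mass
scaling, two-loop scaling, `GapData`, `HasGoldstoneBound`, `PolyVolume` and every calibrated family over `reg₁` that is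
`Live ∧ MassLipschitz` satisfies at every positive tuple the clauses (T ∧ COMP) ∧ CL ∧ CS in exactly U1″'s per-tuple
shape.  The conclusion is the registered signature of U1″ VERBATIM.  The proof is plumbing: A gives `φ` with the
Goldstone bound on `reg.restrict φ`; mass scaling / asymptotic scaling / branch + gap are transported to the subsequence
(§1, adapted from 18044's §3; the two subsequence lemmas are the landed
`StronglyChiralSubsequence.hasMassScaling_restrict` / `hasAsymptoticScaling_restrict`); V gives `reg₁` with the same
`a, β, m_crit, Z_m` as `reg.restrict φ` — i.e. `reg.a ∘ φ` etc. DEFINITIONALLY (`QCDRegularisation.restrict`) — larger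
volumes `reg.L (φ k) = (reg.restrict φ).L k ≤ reg₁.L k`,
polynomial volumes and the Goldstone bound; the same clauses are transported across the volume enlargement (the gap
quantifies over all tori `S ≥ L_k`); B1 gives `𝒞` with `Live` (= per tuple the first three conjuncts of U1″),
`TightGlobal` (UNUSED — U1″ dropped the locally-uniform tightness in r6; it is threaded nowhere) and `MassLipschitz`
(= LIP-T verbatim); D gives (T ∧ COMP), CL, CS.  The bracket TYPE-CHECKS: U1″'s text does not deviate from 18044's
definitions anywhere (quantifier order, coercions, `tsupport (f i)` form, the shape of COMP/CL/CS = Retype-signatures §3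
minus the `Converges` clause — checked textually and by the kernel below).

## Audit of U1″ as typed (worker, ≤ 15 lines)
1. No hypothesis is idle along the intended proof: A consumes all four antecedents (`HasMassScaling`, `IsChiralAtZero`,
   asymptotic scaling, branch + gap); B1 and D re-consume the transported scaling / gap packets.
2. `IsChiralAtZero` is NECESSARY, kernel-checked: `isChiralAtZero_of_tied_hasGoldstoneBound` below — the conclusion's
   `reg₁.HasGoldstoneBound` with the four ties and `reg.L (φ k) ≤ reg₁.L k` already implies `reg.IsChiralAtZero` (a
   uniform gap of `reg` at `m` transports to `reg₁` across ties + volume enlargement, and the Goldstone bound of `reg₁`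
   denies it at its tuple).  So U1″ without `IsChiralAtZero` would assert chirality of every gapped AF regularisation.
3. Not junk-inhabitable by a dead family: `z ≡ 0` / `z → 0` is excluded by `CalibratedSpeciesFamily.z_pos`, by the
   calibration identity `calibrated` (RP-positive reference functions are pinned to `1`) and by the biting clauses
   (`twoPoint … = 1` eventually for `glue` and every flavour-changing `pseudoRe`, `κ₃ ≥ ε > 0`); (T ∧ COMP), CL, CS and
   LIP-T are upper bounds and are compatible with — not substitutes for — these lower bounds.
4. LIP-T is consistent with the per-tuple clauses: it is stated for `n ≠ 0`, compactly supported off-diagonal REAL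
   tensors, per-tuple constants on compacts of positive tuples, eventually and uniformly in `k`; the biting identities
   are constant in `m` (Lipschitz trivially), the per-tuple T bound is pointwise in `m`.  No clause forces `C`, `α` or
   `s` to be uniform in the tuple, so there is no hidden TIGHT.
5. The only junk freedom left is `reg₁.L` (free above `reg.L ∘ φ`): harmless, every clause is monotone or insensitive
   in the volume except the Goldstone LOWER bound, which is exactly what V re-witnesses.

No `sorry`, no new definition, no named fact; standard axioms.
-/

noncomputable section

namespace Summit.QuantumFields.QCD.Cruxes.ThinQCD.Registered

open scoped BigOperators Topology SchwartzMap
open MeasureTheory Filter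
open Literature.MathematicalPhysics.QuantumFieldTheory Literature.MathematicalPhysics.QuantumLattice
  Literature.MathematicalPhysics.AQFT
open Summit.QuantumFields.QCD.Cruxes.StableActionBridge.Sketch (qcdLatticeDist qcdLatticeDistSymAP)
open Summit.QuantumFields.QCD.Theorems.StronglyChiralSubsequence (hasMassScaling_restrict hasAsymptoticScaling_restrict)

variable {Nf : ℕ}

/-! ## §1 Transport of the antecedent packet along a subsequence and across a volume enlargement
(adapted from `Cruxes/ChiralContinuumComplement/Lines/chiral_calibrated_convergence.lean` §3, defs unfolded) -/

namespace CalibratedLatticePackageT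

variable (reg : QCDRegularisation Nf) (φ : ℕ → ℕ) (hφ : StrictMono φ)

/-- Branch + gap at every positive tuple (`GapData`, unfolded) pass to every subsequence (`∀ᶠ` clauses with
`k`-uniform constants). [folklore] -/
theorem gapData_restrict
    (h : ∀ m : Fin Nf → ℝ, (∀ f, 0 < m f) →
      (∀ f, ∀ᶠ k in Filter.atTop, -1 < (reg.scheme m 0 0).mq f k) ∧ ∃ Δ > 0, (reg.scheme m 0 0).HasLatticeMassGap Δ) :
    ∀ m : Fin Nf → ℝ, (∀ f, 0 < m f) →
      (∀ f, ∀ᶠ k in Filter.atTop, -1 < ((reg.restrict φ hφ.tendsto_atTop).scheme m 0 0).mq f k) ∧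
        ∃ Δ > 0, ((reg.restrict φ hφ.tendsto_atTop).scheme m 0 0).HasLatticeMassGap Δ := by
  -- adapted from chiral_calibrated_convergence.lean §3 `gapData_restrict`
  intro m hm
  obtain ⟨hbr, Δ, hΔ, hgap⟩ := h m hm
  refine ⟨fun f => hφ.tendsto_atTop.eventually (hbr f), Δ, hΔ, fun R R' A B => ?_⟩
  obtain ⟨C, hC⟩ := hgap R R' A B
  exact ⟨C, hφ.tendsto_atTop.eventually hC⟩

variable {reg}

/-- `HasMassScaling` reads only `a` and `Z_m`. [folklore] -/
theorem hasMassScaling_of_eq {reg' : QCDRegularisation Nf} (ha : reg'.a = reg.a) (hZ : reg'.Zm = reg.Zm)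
    (h : reg.HasMassScaling) : reg'.HasMassScaling := by
  -- adapted from chiral_calibrated_convergence.lean §3 `hasMassScaling_of_eq`
  obtain ⟨c, hc, ht⟩ := h
  refine ⟨c, hc, ?_⟩
  have hfun : (fun k => reg'.Zm k / Real.log (1 / reg'.a k ^ 2) ^ massExponent Nf) =
      fun k => reg.Zm k / Real.log (1 / reg.a k ^ 2) ^ massExponent Nf := by
    funext k; rw [ha, hZ]
  rw [hfun]
  exact ht

/-- Asymptotic scaling reads only `β` and `a`. [folklore] -/
theorem hasAsymptoticScaling_of_eq {reg' : QCDRegularisation Nf} (ha : reg'.a = reg.a) (hβ : reg'.β = reg.β)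
    (h : (reg.scheme 0 0 0).HasAsymptoticScaling) : (reg'.scheme 0 0 0).HasAsymptoticScaling := by
  -- adapted from chiral_calibrated_convergence.lean §3 `hasAsymptoticScaling_of_eq`
  obtain ⟨Λ, hΛ, ht⟩ := h
  refine ⟨Λ, hΛ, ?_⟩
  have hfun : (fun k => (reg'.scheme 0 0 0).β k - afBeta Nf Λ ((reg'.scheme 0 0 0).a k)) =
      fun k => (reg.scheme 0 0 0).β k - afBeta Nf Λ ((reg.scheme 0 0 0).a k) := by
    funext k; simp [QCDRegularisation.scheme, ha, hβ]
  rw [hfun]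
  exact ht

/-- Branch + gap (`GapData`, unfolded) read `a, β, m_crit, Z_m` and are MONOTONE under volume enlargement (the gap
quantifies over all tori `S ≥ L_k`). [folklore] -/
theorem gapData_of_eq_of_le {reg' : QCDRegularisation Nf} (ha : reg'.a = reg.a) (hβ : reg'.β = reg.β)
    (hmc : reg'.mcrit = reg.mcrit) (hZ : reg'.Zm = reg.Zm) (hL : ∀ k, reg.L k ≤ reg'.L k)
    (h : ∀ m : Fin Nf → ℝ, (∀ f, 0 < m f) →
      (∀ f, ∀ᶠ k in Filter.atTop, -1 < (reg.scheme m 0 0).mq f k) ∧ ∃ Δ > 0, (reg.scheme m 0 0).HasLatticeMassGap Δ) :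
    ∀ m : Fin Nf → ℝ, (∀ f, 0 < m f) →
      (∀ f, ∀ᶠ k in Filter.atTop, -1 < (reg'.scheme m 0 0).mq f k) ∧ ∃ Δ > 0, (reg'.scheme m 0 0).HasLatticeMassGap Δ := by
  -- adapted from chiral_calibrated_convergence.lean §3 `gapData_of_eq_of_le`
  intro m hm
  obtain ⟨hbr, Δ, hΔ, hgap⟩ := h m hm
  refine ⟨fun f => (hbr f).mono fun k hk => ?_, Δ, hΔ, fun R R' A B => ?_⟩
  · simpa [QCDRegularisation.scheme_mq, ha, hmc, hZ] using hk
  · obtain ⟨C, hC⟩ := hgap R R' A B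
    refine ⟨C, hC.mono fun k hk S hS n hn => ?_⟩
    have hS' : (reg.scheme m 0 0).L k ≤ S := (hL k).trans (by simpa [QCDRegularisation.scheme] using hS)
    simpa [QCDRegularisation.scheme, ha, hβ, hmc, hZ] using hk S hS' n hn

include hφ in
/-- A uniform lattice gap of `reg` at the tuple `m` transports to any `reg₁` tied to `reg` along `φ → ∞`
(`a, β, m_crit, Z_m` composed with `φ`) with volumes only enlarged (`reg.L (φ k) ≤ reg₁.L k`). [folklore] -/
theorem hasLatticeMassGap_of_tied {reg₁ : QCDRegularisation Nf} (ha : reg₁.a = reg.a ∘ φ) (hβ : reg₁.β = reg.β ∘ φ)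
    (hmc : reg₁.mcrit = reg.mcrit ∘ φ) (hZm : reg₁.Zm = reg.Zm ∘ φ) (hL : ∀ k, reg.L (φ k) ≤ reg₁.L k)
    {m : Fin Nf → ℝ} {Δ : ℝ} (h : (reg.scheme m 0 0).HasLatticeMassGap Δ) : (reg₁.scheme m 0 0).HasLatticeMassGap Δ := by
  -- adapted from Cruxes/ThinQCD/Lines/birth.lean §3 `gap_transport` (no reindexing of the family)
  intro R R' A B
  obtain ⟨C, hC⟩ := h R R' A B
  refine ⟨C, (hφ.tendsto_atTop.eventually hC).mono fun k hk S hS n hn => ?_⟩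
  have hS' : (reg.scheme m 0 0).L (φ k) ≤ S := (hL k).trans (by simpa [QCDRegularisation.scheme] using hS)
  simpa [QCDRegularisation.scheme, ha, hβ, hmc, hZm] using hk S hS' n hn

end CalibratedLatticePackageT

open CalibratedLatticePackageT

/-! ## §2 Audit record: the hypothesis `IsChiralAtZero` of U1″ is necessary -/

/-- **`IsChiralAtZero` is necessary in U1″.**  If `reg₁` is tied to `reg` along a strictly increasing `φ` (`a, β,
m_crit, Z_m` composed with `φ`, volumes only enlarged) and `reg₁` has the eventual Goldstone bound, then `reg` is
chiral at zero: a uniform lattice gap `ε` of `reg` at the Goldstone tuple would transport to `reg₁`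
(`hasLatticeMassGap_of_tied`) and contradict `HasGoldstoneBoundAt.exists_not_hasLatticeMassGap`. [folklore] -/
theorem isChiralAtZero_of_tied_hasGoldstoneBound {reg reg₁ : QCDRegularisation Nf} {φ : ℕ → ℕ} (hφ : StrictMono φ)
    (ha : reg₁.a = reg.a ∘ φ) (hβ : reg₁.β = reg.β ∘ φ) (hmc : reg₁.mcrit = reg.mcrit ∘ φ)
    (hZm : reg₁.Zm = reg.Zm ∘ φ) (hL : ∀ k, reg.L (φ k) ≤ reg₁.L k) (hG : reg₁.HasGoldstoneBound) :
    reg.IsChiralAtZero := by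
  intro ε hε
  obtain ⟨m, hm, hng⟩ := (hG ε hε).exists_not_hasLatticeMassGap
  exact ⟨m, hm, fun hgap => hng (hasLatticeMassGap_of_tied φ hφ ha hβ hmc hZm hL hgap)⟩

/-! ## §3 The upstream bracket `A → V → B1 → D → U1″` (kernel-checked; conclusion = the registered signature verbatim) -/

/-- **U1″ from 18044's registered stubs A, V, B1 and the deliverables law D.**  Hypotheses, in order: (A) the body of
`ChiralGoldstoneSubsequence`, (V) the body of `GoldstoneVolumeUpgrade`, (B1) the body of `CalibratedControl`
(`Live ∧ TightGlobal ∧ MassLipschitz`; `TightGlobal` is carried but NOT used), all with the §0 abbreviations of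
`Cruxes/ChiralContinuumComplement/Lines/chiral_calibrated_convergence.lean` unfolded verbatim, and (D) the deliverables
law of the certified re-type 18044′ ((T ∧ COMP) ∧ CL ∧ CS per positive tuple for every live, mass-Lipschitz calibrated
family over an honestly chiral, gapped, AF, polynomial-volume regularisation).  Conclusion: the registered signature of
`stub_calibratedLatticePackageT` verbatim.  Witness `(φ, reg₁, 𝒞)` with `reg₁` the volume upgrade of `reg.restrict φ`:
the four ties hold by `rfl` after V's equalities, the volume inequality is V's, chirality is the Goldstone bound. -/
theorem calibratedLatticePackageT_of_upstream :
    (∀ Nf : ℕ, Nf = 2 ∨ Nf = 3 → ∀ reg : QCDRegularisation Nf, reg.HasMassScaling → reg.IsChiralAtZero →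
      (reg.scheme 0 0 0).HasAsymptoticScaling →
      (∀ m : Fin Nf → ℝ, (∀ f, 0 < m f) →
        (∀ f, ∀ᶠ k in Filter.atTop, -1 < (reg.scheme m 0 0).mq f k) ∧ ∃ Δ > 0, (reg.scheme m 0 0).HasLatticeMassGap Δ) →
      ∃ (φ : ℕ → ℕ) (hφ : StrictMono φ), (reg.restrict φ hφ.tendsto_atTop).HasGoldstoneBound) →
    (∀ Nf : ℕ, Nf = 2 ∨ Nf = 3 → ∀ reg : QCDRegularisation Nf, (reg.scheme 0 0 0).HasAsymptoticScaling →
      (∀ m : Fin Nf → ℝ, (∀ f, 0 < m f) →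
        (∀ f, ∀ᶠ k in Filter.atTop, -1 < (reg.scheme m 0 0).mq f k) ∧ ∃ Δ > 0, (reg.scheme m 0 0).HasLatticeMassGap Δ) →
      reg.HasGoldstoneBound →
      ∃ reg' : QCDRegularisation Nf, reg'.a = reg.a ∧ reg'.β = reg.β ∧ reg'.mcrit = reg.mcrit ∧ reg'.Zm = reg.Zm ∧
        (∀ k, reg.L k ≤ reg'.L k) ∧ (∃ θ : ℝ, 0 < θ ∧ ∀ᶠ k in Filter.atTop, reg'.a k ^ (-θ) ≤ reg'.a k * (reg'.L k : ℝ)) ∧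
        reg'.HasGoldstoneBound) →
    (∀ Nf : ℕ, Nf = 2 ∨ Nf = 3 → ∀ reg : QCDRegularisation Nf, reg.HasMassScaling →
      (reg.scheme 0 0 0).HasAsymptoticScaling →
      (∀ m : Fin Nf → ℝ, (∀ f, 0 < m f) →
        (∀ f, ∀ᶠ k in Filter.atTop, -1 < (reg.scheme m 0 0).mq f k) ∧ ∃ Δ > 0, (reg.scheme m 0 0).HasLatticeMassGap Δ) →
      reg.HasGoldstoneBound → (∃ θ : ℝ, 0 < θ ∧ ∀ᶠ k in Filter.atTop, reg.a k ^ (-θ) ≤ reg.a k * (reg.L k : ℝ)) →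
      ∃ 𝒞 : CalibratedSpeciesFamily reg,
        (∀ m : Fin Nf → ℝ, (∀ f, 0 < m f) →
          ((∀ᶠ k in Filter.atTop,
            (𝒞.scheme m).twoPoint k QCDField.glue QCDField.glue (thetaTest 4 𝒞.f₀) 𝒞.f₀ = 1) ∧
          (∀ f g : Fin Nf, f ≠ g → ∀ᶠ k in Filter.atTop,
            (𝒞.scheme m).twoPoint k (QCDField.pseudoRe f g) (QCDField.pseudoRe f g) (thetaTest 4 𝒞.f₀) 𝒞.f₀ = 1)) ∧
          (∃ f g h : SchwartzMap (EuclideanSpace ℝ (Fin 4)) ℝ,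
            tsupport (f : EuclideanSpace ℝ (Fin 4) → ℝ) ⊆ {x | x 0 < 0} ∧
            tsupport (g : EuclideanSpace ℝ (Fin 4) → ℝ) ⊆ {x | 0 < x 0 ∧ x 0 < 1} ∧
            tsupport (h : EuclideanSpace ℝ (Fin 4) → ℝ) ⊆ {x | 1 < x 0} ∧
            ∃ ε > (0 : ℝ), ∀ᶠ k in Filter.atTop, ε ≤ ‖qcdLatticeSchwinger (𝒞.scheme m) k 3
              ![QCDField.glue, QCDField.glue, QCDField.glue] ![f, g, h] -
              qcdLatticeSchwinger (𝒞.scheme m) k 1 ![QCDField.glue] ![f] *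
                qcdLatticeSchwinger (𝒞.scheme m) k 2 ![QCDField.glue, QCDField.glue] ![g, h] -
              qcdLatticeSchwinger (𝒞.scheme m) k 1 ![QCDField.glue] ![g] *
                qcdLatticeSchwinger (𝒞.scheme m) k 2 ![QCDField.glue, QCDField.glue] ![f, h] -
              qcdLatticeSchwinger (𝒞.scheme m) k 1 ![QCDField.glue] ![h] *
                qcdLatticeSchwinger (𝒞.scheme m) k 2 ![QCDField.glue, QCDField.glue] ![f, g] +
              2 * (qcdLatticeSchwinger (𝒞.scheme m) k 1 ![QCDField.glue] ![f] *
                qcdLatticeSchwinger (𝒞.scheme m) k 1 ![QCDField.glue] ![g] *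
                qcdLatticeSchwinger (𝒞.scheme m) k 1 ![QCDField.glue] ![h])‖)) ∧
        (∀ K : Set (Fin Nf → ℝ), IsCompact K → K ⊆ {m | ∀ fl, 0 < m fl} →
          ∃ (s : ℕ) (α β : ℝ), ∀ᶠ k in Filter.atTop, ∀ m ∈ K, ∀ (n : ℕ) (σ : Fin n → QCDField Nf)
            (f : Fin n → SchwartzMap (EuclideanSpace ℝ (Fin 4)) ℝ) (F : SchwartzMap (Fin n → EuclideanSpace ℝ (Fin 4)) ℂ),
            IsTensorOf F (fun i => ofRealTest (f i)) → IsOffDiagonal F →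
              ‖qcdLatticeSchwinger (𝒞.scheme m) k n σ f‖ ≤ α * (n.factorial : ℝ) ^ β * schwartzNorm (n * s) F) ∧
        (∀ n : ℕ, n ≠ 0 → ∀ (σ : Fin n → QCDField Nf) (f : Fin n → SchwartzMap (EuclideanSpace ℝ (Fin 4)) ℝ)
          (F : SchwartzMap (Fin n → EuclideanSpace ℝ (Fin 4)) ℂ), IsTensorOf F (fun i => ofRealTest (f i)) →
            IsOffDiagonal F → ∀ R : ℝ, (∀ i, tsupport (f i) ⊆ Metric.closedBall 0 R) →
              ∀ K : Set (Fin Nf → ℝ), IsCompact K → K ⊆ {m | ∀ fl, 0 < m fl} →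
                ∃ C : ℝ, ∀ᶠ k in Filter.atTop, ∀ m ∈ K, ∀ m' ∈ K,
                  ‖qcdLatticeSchwinger (𝒞.scheme m) k n σ f - qcdLatticeSchwinger (𝒞.scheme m') k n σ f‖ ≤
                    C * ‖m - m'‖)) →
    (∀ Nf : ℕ, Nf = 2 ∨ Nf = 3 → ∀ reg : QCDRegularisation Nf, reg.HasMassScaling →
      (reg.scheme 0 0 0).HasAsymptoticScaling →
      (∀ m : Fin Nf → ℝ, (∀ f, 0 < m f) →
        (∀ f, ∀ᶠ k in Filter.atTop, -1 < (reg.scheme m 0 0).mq f k) ∧ ∃ Δ > 0, (reg.scheme m 0 0).HasLatticeMassGap Δ) →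
      reg.HasGoldstoneBound → (∃ θ : ℝ, 0 < θ ∧ ∀ᶠ k in Filter.atTop, reg.a k ^ (-θ) ≤ reg.a k * (reg.L k : ℝ)) →
      ∀ 𝒞 : CalibratedSpeciesFamily reg,
        (∀ m : Fin Nf → ℝ, (∀ f, 0 < m f) →
          ((∀ᶠ k in Filter.atTop,
            (𝒞.scheme m).twoPoint k QCDField.glue QCDField.glue (thetaTest 4 𝒞.f₀) 𝒞.f₀ = 1) ∧
          (∀ f g : Fin Nf, f ≠ g → ∀ᶠ k in Filter.atTop,
            (𝒞.scheme m).twoPoint k (QCDField.pseudoRe f g) (QCDField.pseudoRe f g) (thetaTest 4 𝒞.f₀) 𝒞.f₀ = 1)) ∧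
          (∃ f g h : SchwartzMap (EuclideanSpace ℝ (Fin 4)) ℝ,
            tsupport (f : EuclideanSpace ℝ (Fin 4) → ℝ) ⊆ {x | x 0 < 0} ∧
            tsupport (g : EuclideanSpace ℝ (Fin 4) → ℝ) ⊆ {x | 0 < x 0 ∧ x 0 < 1} ∧
            tsupport (h : EuclideanSpace ℝ (Fin 4) → ℝ) ⊆ {x | 1 < x 0} ∧
            ∃ ε > (0 : ℝ), ∀ᶠ k in Filter.atTop, ε ≤ ‖qcdLatticeSchwinger (𝒞.scheme m) k 3
              ![QCDField.glue, QCDField.glue, QCDField.glue] ![f, g, h] -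
              qcdLatticeSchwinger (𝒞.scheme m) k 1 ![QCDField.glue] ![f] *
                qcdLatticeSchwinger (𝒞.scheme m) k 2 ![QCDField.glue, QCDField.glue] ![g, h] -
              qcdLatticeSchwinger (𝒞.scheme m) k 1 ![QCDField.glue] ![g] *
                qcdLatticeSchwinger (𝒞.scheme m) k 2 ![QCDField.glue, QCDField.glue] ![f, h] -
              qcdLatticeSchwinger (𝒞.scheme m) k 1 ![QCDField.glue] ![h] *
                qcdLatticeSchwinger (𝒞.scheme m) k 2 ![QCDField.glue, QCDField.glue] ![f, g] +
              2 * (qcdLatticeSchwinger (𝒞.scheme m) k 1 ![QCDField.glue] ![f] *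
                qcdLatticeSchwinger (𝒞.scheme m) k 1 ![QCDField.glue] ![g] *
                qcdLatticeSchwinger (𝒞.scheme m) k 1 ![QCDField.glue] ![h])‖)) →
        (∀ n : ℕ, n ≠ 0 → ∀ (σ : Fin n → QCDField Nf) (f : Fin n → SchwartzMap (EuclideanSpace ℝ (Fin 4)) ℝ)
          (F : SchwartzMap (Fin n → EuclideanSpace ℝ (Fin 4)) ℂ), IsTensorOf F (fun i => ofRealTest (f i)) →
            IsOffDiagonal F → ∀ R : ℝ, (∀ i, tsupport (f i) ⊆ Metric.closedBall 0 R) →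
              ∀ K : Set (Fin Nf → ℝ), IsCompact K → K ⊆ {m | ∀ fl, 0 < m fl} →
                ∃ C : ℝ, ∀ᶠ k in Filter.atTop, ∀ m ∈ K, ∀ m' ∈ K,
                  ‖qcdLatticeSchwinger (𝒞.scheme m) k n σ f - qcdLatticeSchwinger (𝒞.scheme m') k n σ f‖ ≤
                    C * ‖m - m'‖) →
        ∀ m : Fin Nf → ℝ, (∀ f, 0 < m f) →
          (∃ (s : ℕ) (α β : ℝ), 0 ≤ α ∧
            (∀ (n : ℕ) (σ : Fin n → QCDField Nf), ∀ᶠ k in Filter.atTop,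
              ∀ F : SchwartzMap (Fin n → EuclideanSpace ℝ (Fin 4)) ℂ, IsOffDiagonal F →
                ‖qcdLatticeDist (𝒞.scheme m) k n σ F‖ ≤ α * (n.factorial : ℝ) ^ β * schwartzNorm (n * s) F) ∧
            (∀ ε : ℝ, 0 < ε → ∀ (n : ℕ) (σ : Fin n → QCDField Nf), ∀ᶠ k in Filter.atTop,
              ∀ F : SchwartzMap (Fin n → EuclideanSpace ℝ (Fin 4)) ℂ, IsOffDiagonal F →
                ‖qcdLatticeDistSymAP (𝒞.scheme m) k n σ F - qcdLatticeDist (𝒞.scheme m) k n σ F‖ ≤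
                  ε * schwartzNorm (n * s) F)) ∧
          (∀ (n n' : ℕ) (σ : Fin n → QCDField Nf) (σ' : Fin n' → QCDField Nf)
            (F : SchwartzMap (Fin n → EuclideanSpace ℝ (Fin 4)) ℂ) (G : SchwartzMap (Fin n' → EuclideanSpace ℝ (Fin 4)) ℂ),
            IsTimeOrdered F → IsTimeOrdered G → ∀ a : EuclideanSpace ℝ (Fin 4), a 0 = 0 → a ≠ 0 →
            ∀ ε : ℝ, 0 < ε → ∃ t₀ : ℝ, ∀ t : ℝ, t₀ ≤ t →
              ∀ H : SchwartzMap (Fin (n + n') → EuclideanSpace ℝ (Fin 4)) ℂ,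
                IsAppendTensorOf H (osAdjoint F) (translateMulti (t • a) G) →
                ∀ᶠ k in Filter.atTop, ‖qcdLatticeDist (𝒞.scheme m) k (n + n') (Fin.append (σ ∘ Fin.rev) σ') H -
                  qcdLatticeDist (𝒞.scheme m) k n (σ ∘ Fin.rev) (osAdjoint F) *
                    qcdLatticeDist (𝒞.scheme m) k n' σ' G‖ ≤ ε) ∧
          (∃ Δ' > 0, (𝒞.scheme m).HasSpeciesCSClustering Δ')) →
    ∀ Nf : ℕ, Nf = 2 ∨ Nf = 3 → ∀ reg : QCDRegularisation Nf, reg.HasMassScaling → reg.IsChiralAtZero →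
    (reg.scheme 0 0 0).HasAsymptoticScaling →
    (∀ m : Fin Nf → ℝ, (∀ f, 0 < m f) →
      (∀ f, ∀ᶠ k in Filter.atTop, -1 < (reg.scheme m 0 0).mq f k) ∧ ∃ Δ > 0, (reg.scheme m 0 0).HasLatticeMassGap Δ) →
    ∃ (φ : ℕ → ℕ) (reg₁ : QCDRegularisation Nf), StrictMono φ ∧ reg₁.a = reg.a ∘ φ ∧ reg₁.β = reg.β ∘ φ ∧
      reg₁.mcrit = reg.mcrit ∘ φ ∧ reg₁.Zm = reg.Zm ∘ φ ∧ (∀ k, reg.L (φ k) ≤ reg₁.L k) ∧ reg₁.HasGoldstoneBound ∧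
      ∃ 𝒞 : CalibratedSpeciesFamily reg₁,
        (∀ n : ℕ, n ≠ 0 → ∀ (σ : Fin n → QCDField Nf) (f : Fin n → SchwartzMap (EuclideanSpace ℝ (Fin 4)) ℝ)
          (F : SchwartzMap (Fin n → EuclideanSpace ℝ (Fin 4)) ℂ), IsTensorOf F (fun i => ofRealTest (f i)) →
            IsOffDiagonal F → ∀ R : ℝ, (∀ i, tsupport (f i) ⊆ Metric.closedBall 0 R) →
              ∀ K : Set (Fin Nf → ℝ), IsCompact K → K ⊆ {m | ∀ fl, 0 < m fl} →
                ∃ C : ℝ, ∀ᶠ k in Filter.atTop, ∀ m ∈ K, ∀ m' ∈ K,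
                  ‖qcdLatticeSchwinger (𝒞.scheme m) k n σ f - qcdLatticeSchwinger (𝒞.scheme m') k n σ f‖ ≤
                    C * ‖m - m'‖) ∧
        ∀ m : Fin Nf → ℝ, (∀ f, 0 < m f) →
          (∀ᶠ k in Filter.atTop,
            (𝒞.scheme m).twoPoint k QCDField.glue QCDField.glue (thetaTest 4 𝒞.f₀) 𝒞.f₀ = 1) ∧
          (∀ f g : Fin Nf, f ≠ g → ∀ᶠ k in Filter.atTop,
            (𝒞.scheme m).twoPoint k (QCDField.pseudoRe f g) (QCDField.pseudoRe f g) (thetaTest 4 𝒞.f₀) 𝒞.f₀ = 1) ∧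
          (∃ f g h : SchwartzMap (EuclideanSpace ℝ (Fin 4)) ℝ,
            tsupport (f : EuclideanSpace ℝ (Fin 4) → ℝ) ⊆ {x | x 0 < 0} ∧
            tsupport (g : EuclideanSpace ℝ (Fin 4) → ℝ) ⊆ {x | 0 < x 0 ∧ x 0 < 1} ∧
            tsupport (h : EuclideanSpace ℝ (Fin 4) → ℝ) ⊆ {x | 1 < x 0} ∧
            ∃ ε > (0 : ℝ), ∀ᶠ k in Filter.atTop, ε ≤ ‖qcdLatticeSchwinger (𝒞.scheme m) k 3
              ![QCDField.glue, QCDField.glue, QCDField.glue] ![f, g, h] -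
              qcdLatticeSchwinger (𝒞.scheme m) k 1 ![QCDField.glue] ![f] *
                qcdLatticeSchwinger (𝒞.scheme m) k 2 ![QCDField.glue, QCDField.glue] ![g, h] -
              qcdLatticeSchwinger (𝒞.scheme m) k 1 ![QCDField.glue] ![g] *
                qcdLatticeSchwinger (𝒞.scheme m) k 2 ![QCDField.glue, QCDField.glue] ![f, h] -
              qcdLatticeSchwinger (𝒞.scheme m) k 1 ![QCDField.glue] ![h] *
                qcdLatticeSchwinger (𝒞.scheme m) k 2 ![QCDField.glue, QCDField.glue] ![f, g] +
              2 * (qcdLatticeSchwinger (𝒞.scheme m) k 1 ![QCDField.glue] ![f] *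
                qcdLatticeSchwinger (𝒞.scheme m) k 1 ![QCDField.glue] ![g] *
                qcdLatticeSchwinger (𝒞.scheme m) k 1 ![QCDField.glue] ![h])‖) ∧
          (∃ (s : ℕ) (α β : ℝ), 0 ≤ α ∧
            (∀ (n : ℕ) (σ : Fin n → QCDField Nf), ∀ᶠ k in Filter.atTop,
              ∀ F : SchwartzMap (Fin n → EuclideanSpace ℝ (Fin 4)) ℂ, IsOffDiagonal F →
                ‖qcdLatticeDist (𝒞.scheme m) k n σ F‖ ≤ α * (n.factorial : ℝ) ^ β * schwartzNorm (n * s) F) ∧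
            (∀ ε : ℝ, 0 < ε → ∀ (n : ℕ) (σ : Fin n → QCDField Nf), ∀ᶠ k in Filter.atTop,
              ∀ F : SchwartzMap (Fin n → EuclideanSpace ℝ (Fin 4)) ℂ, IsOffDiagonal F →
                ‖qcdLatticeDistSymAP (𝒞.scheme m) k n σ F - qcdLatticeDist (𝒞.scheme m) k n σ F‖ ≤
                  ε * schwartzNorm (n * s) F)) ∧
          (∀ (n n' : ℕ) (σ : Fin n → QCDField Nf) (σ' : Fin n' → QCDField Nf)
            (F : SchwartzMap (Fin n → EuclideanSpace ℝ (Fin 4)) ℂ) (G : SchwartzMap (Fin n' → EuclideanSpace ℝ (Fin 4)) ℂ),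
            IsTimeOrdered F → IsTimeOrdered G → ∀ a : EuclideanSpace ℝ (Fin 4), a 0 = 0 → a ≠ 0 →
            ∀ ε : ℝ, 0 < ε → ∃ t₀ : ℝ, ∀ t : ℝ, t₀ ≤ t →
              ∀ H : SchwartzMap (Fin (n + n') → EuclideanSpace ℝ (Fin 4)) ℂ,
                IsAppendTensorOf H (osAdjoint F) (translateMulti (t • a) G) →
                ∀ᶠ k in Filter.atTop, ‖qcdLatticeDist (𝒞.scheme m) k (n + n') (Fin.append (σ ∘ Fin.rev) σ') H -
                  qcdLatticeDist (𝒞.scheme m) k n (σ ∘ Fin.rev) (osAdjoint F) *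
                    qcdLatticeDist (𝒞.scheme m) k n' σ' G‖ ≤ ε) ∧
          (∃ Δ' > 0, (𝒞.scheme m).HasSpeciesCSClustering Δ') := by
  intro hA hV hB hD Nf hNf reg hms hchi has hgap
  -- (A) the Goldstone subsequence `reg.restrict φ`
  obtain ⟨φ, hφ, hG₀⟩ := hA Nf hNf reg hms hchi has hgap
  have hms₀ := hasMassScaling_restrict reg φ hφ hms
  have has₀ := hasAsymptoticScaling_restrict reg φ hφ has
  have hgap₀ := gapData_restrict reg φ hφ hgap
  -- (V) the volume upgrade `reg₁` of `reg.restrict φ` (same bare data, larger polynomial volumes, Goldstone bound)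
  obtain ⟨reg₁, ha₁, hβ₁, hmc₁, hZ₁, hL₁, hpoly₁, hG₁⟩ := hV Nf hNf (reg.restrict φ hφ.tendsto_atTop) has₀ hgap₀ hG₀
  have hms₁ : reg₁.HasMassScaling := hasMassScaling_of_eq ha₁ hZ₁ hms₀
  have has₁ : (reg₁.scheme 0 0 0).HasAsymptoticScaling := hasAsymptoticScaling_of_eq ha₁ hβ₁ has₀
  have hgap₁ := gapData_of_eq_of_le ha₁ hβ₁ hmc₁ hZ₁ hL₁ hgap₀
  -- (B1) calibrated control on `reg₁`: liveness, global tightness (unused), tensor mass-Lipschitz modulus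
  obtain ⟨𝒞, hlive, -, hlip⟩ := hB Nf hNf reg₁ hms₁ has₁ hgap₁ hG₁ hpoly₁
  -- (D) the per-tuple deliverables of `𝒞`
  have hdel := hD Nf hNf reg₁ hms₁ has₁ hgap₁ hG₁ hpoly₁ 𝒞 hlive hlip
  refine ⟨φ, reg₁, hφ, ha₁, hβ₁, hmc₁, hZ₁, fun k => hL₁ k, hG₁, 𝒞, hlip, fun m hm => ?_⟩
  obtain ⟨⟨hb₁, hb₂⟩, hk₃⟩ := hlive m hm
  obtain ⟨hT, hCL, hCS⟩ := hdel m hm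
  exact ⟨hb₁, hb₂, hk₃, hT, hCL, hCS⟩

end Summit.QuantumFields.QCD.Cruxes.ThinQCD.Registered

end
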